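/-
Copyright (c) 2026 the pub-hodgecm-mathlib formalisation cell (harness21).  Prover seat hodgecm-mathlib-F0P3b-p01 (g13): «S3-ram» seeding wave (LEAD F0P3a-plan (g12);
owner F0P3a-p06 (g15); architect A-p16 (g31)), row (a′) «UNIVERSAL-TO-FRAMED REDUCTION» for the socket (Σ)′ of the type-(1) row; 2026-09-02.
-/
import Literature.NumberTheory.Rogawski1990.DepthZeroKappaTransferTypeOneRamifiedSockets   -- ★ p847383 + ED. 2 p847439 (this seat): (E), (Lit), (Lit⁺) `typeOne_literals_framed_ram`
import HarnessLib

/-!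
# (a′) Universal-to-framed reduction for the κ-signed class sum over the four ramified type-(1) literals (Rogawski 1990 §4.3, §4.9; Flicker 1998 §6)

Topic `NumberTheory/Rogawski1990`; namespace `Literature.NumberTheory.Rogawski1990`.  ONE THEOREM (no definition, no named fact, no instance, no notation, no `sorry`).
Cell `pub/hodgecm-mathlib`, crux H413 (`--supports stmt-HodgeConjecture-24833`), «S3-ram» seeding wave.  The socket (Σ)′ of A-p16 (g31)'s type-(1) row (skeleton v7
`stub_typeOne_signedClassSum_ram` + the pin of ref5 R-311 (4)) quantifies UNIVERSALLY over a quadruple `t : Fin 2 → Fin 2 → G′_v` matched with `γ_H`, pairwise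
non-conjugate, with κ-signs `s·(−1)^(b₁)` and `(s : ℂ) = (y_λ, θ)_v`; the junction (J★) of F0P3a-p01 (g16) counts lattices for the FRAMED literals
`e(tf_b) = P_b · diag(α, u_w, γ) · P_b⁻¹`, `ᵗσ̄_w P_b J₀ P_b = diag(ε^b₀, ε^b₁, −ε^(b₀+b₁))` of ★ `typeOne_literals_framed_ram`.  This file is the brick in between:
`exists_framed_relabelling_of_literals_ram` — every admissible quadruple is, class by class and WITH THE SAME second label `b₁`, the framed quadruple (a relabelling
`π(·, b₁)` of the first label only), so that `Σ_b (−1)^(b₁) Φ(⟦t_b⟧) = Σ_b (−1)^(b₁) Φ(⟦tf_b⟧)` for every class function `Φ`.  Inputs: ★ `typeOne_literals_framed_ram`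
((Lit⁺)), ★ `ncard_conjClassesIn_eq_four` (`|H¹(T)| = 4` at a non-split place, ★ p847076's bridge `exists_localRing_frame_of_onePlace_frame`), ★ `finKappaAt_eq_of_isConj`
(κ is a class function), ★ `map_conjLocal_transpose_localForm` ∕ `isUnit_det_localForm`.  Without the pin the statement is false (relabel `b₁ ↦ 1 − b₁`, `s ↦ −s`).
HONEST LABEL: HC_CM is proved only modulo the 2 remaining named inputs (hLiu418 24832, h413 24833) until rung 0 closes; no books consequence.

## References
* [Rogawski1990] J. D. Rogawski, *Automorphic Representations of Unitary Groups in Three Variables*, Ann. of Math. Stud. 123 (1990), §4.3 (4.3.1)–(4.3.2) p. 43, §4.9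
  Prop. 4.9.1 p. 55, §3.5 Prop. 3.5.2 (c) p. 26, §3.6 pp. 28–29.
* [Flicker1998UnitaryFL] Y. Z. Flicker, *Elementary proof of the fundamental lemma for a unitary group*, Canad. J. Math. 50 (1998), §2 Prop. 3 pp. 78–79, §6 p. 95.
* [LabesseLanglands1979] J.-P. Labesse, R. P. Langlands, *L-indistinguishability for SL(2)*, Canad. J. Math. 31 (1979), §2 pp. 8–9.
-/

set_option autoImplicit false

noncomputable section

open NumberField IsDedekindDomain Matrix Filter Topology Polynomial
open scoped MatrixGroups ValuativeRel

namespace Literature.NumberTheory.Rogawski1990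

open Literature.NumberTheory.Automorphic Literature.NumberTheory.Automorphic.UnitaryGroup
open Literature.NumberTheory.GaloisRepresentations Literature.NumberTheory.NumberFields Literature.NumberTheory.QuadraticForms

section FramedReduction

set_option maxHeartbeats 1600000 in
/-- **(a′) UNIVERSAL-TO-FRAMED REDUCTION under the pin.**  For a `G`-regular non-Levi type-(1) `γ_H`, distinct roots `α ≠ γ` of `χ_{g,w}`, and ANY quadruple `t` matched with
`γ_H`, pairwise non-conjugate, with κ-signs `κ_v(γ_H, t_b) = s·(−1)^(b₁)` AND the pin `(s : ℂ) = (y_λ, θ)_v`: the framed package of ★ `typeOne_literals_framed_ram` `(ε, e, P, tf)` at the spectrum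
`(α, u_w, γ)` (all clauses of ★ `typeOne_literals_framed_ram`, κ-signs with the SAME `s`) and a relabelling `π` with `π(·, b₁)` bijective and `t (π b₀ b₁) b₁ ~ tf b₀ b₁`
(conjugate in `G′_v`).  Mechanism: the four classes `⟦tf_b⟧` exhaust the stable class (★ `ncard_conjClassesIn_eq_four`, `|H¹| = 4`), so each `t_b` is conjugate to exactly one
`tf_{b′}`; `κ_v(γ_H, ·)` is a class function (★ `finKappaAt_eq_of_isConj`) and both pins read the same Hilbert symbol, so `s′ = s` and `(−1)^(b′₁) = (−1)^(b₁)`, i.e.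
`b′₁ = b₁`; pairwise non-conjugacy of `t` makes `b ↦ b′` injective, hence a bijection of `Fin 2 × Fin 2` preserving the second label.  WITHOUT the pin the statement fails
(relabel `t b₀ b₁ ↦ t b₀ (1 − b₁)`, `s ↦ −s`).  Consequently `Σ_b (−1)^(b₁) Φ(⟦t_b⟧, f) = Σ_b (−1)^(b₁) Φ(⟦tf_b⟧, f)` for every class function `Φ` (reindex `b₀`).
[cite: Rogawski1990, §4.3 (4.3.1)–(4.3.2) p. 43; §3.5 Prop. 3.5.2 (c) p. 26; §3.6 pp. 28–29] [cite: Flicker1998UnitaryFL, §6 p. 95] [cite: LabesseLanglands1979, §2 pp. 8–9] -/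
theorem exists_framed_relabelling_of_literals_ram
    (L : Type) [Field L] [NumberField L] [IsCMField L] (H' : Matrix (Fin 3) (Fin 3) L)
    {v : HeightOneSpectrum (𝓞 ↥(maximalRealSubfield L))}
    (hH' : (H'.map (cmConjRingHom L)).transpose = H') (w : PlacesOver L v)
    (hw : IsCMField.complexConj L • w.1 = w.1) (he : v.asIdeal.ramificationIdx' w.1.asIdeal ≠ 1)
    (hH'w : IsUnit (placeForm H' w.1))
    (h2 : IsUnit (2 : 𝒪[w.1.adicCompletion L]))
    -- the integral antidiagonal frame of `H′_w` (★ p846344)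
    (A : GL (Fin 3) (w.1.adicCompletion L)) (hA : A ∈ glInt 3 (w.1.adicCompletion L))
    (hframe : placeForm H' w.1 = (-(placeForm H' w.1).det) • formCongr (galAdicCompletionMap (L := L) (IsCMField.complexConj L) hw) A ((StdForm.antidiagonal 3).over (w.1.adicCompletion L)))
    -- `y_λ ∈ L⁺_v` with `ι_w y_λ = −det H′_w` (the C-Δ Levi value's Hilbert symbol `(y_λ, θ)_v`)
    (yl : v.adicCompletion ↥(maximalRealSubfield L)) (hyl : toPlace v w yl = -(placeForm H' w.1).det)
    (γH : ((cmDatum L 2 (Matrix.of fun i j : Fin 2 => if i.val + j.val + 1 = 2 then (1 : L) else 0)).Local v × (cmDatum L 1 (Matrix.of fun i j : Fin 1 => if i.val + j.val + 1 = 1 then (1 : L) else 0)).Local v))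
    (hreg : IsLocalGRegular L v γH)
    (hlev : ¬ (∃ (y : ((cmDatum L 2 (Matrix.of fun i j : Fin 2 => if i.val + j.val + 1 = 2 then (1 : L) else 0)).Local v × (cmDatum L 1 (Matrix.of fun i j : Fin 1 => if i.val + j.val + 1 = 1 then (1 : L) else 0)).Local v)) (d' : Fin 2 → (UnitaryGroup.LocalRing L v)ˣ),
          glDiagonal 2 (UnitaryGroup.LocalRing L v) d' = ((y * γH * y⁻¹).1.val : GL (Fin 2) (UnitaryGroup.LocalRing L v))))
    {α γ : (w.1.adicCompletion L)}
    (hα : ((((γH.1.val : GL (Fin 2) (UnitaryGroup.LocalRing L v)) : Matrix (Fin 2) (Fin 2) (UnitaryGroup.LocalRing L v)).charpoly).map (Pi.evalRingHom (fun w' : PlacesOver L v => w'.1.adicCompletion L) w)).IsRoot α)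
    (hγ : ((((γH.1.val : GL (Fin 2) (UnitaryGroup.LocalRing L v)) : Matrix (Fin 2) (Fin 2) (UnitaryGroup.LocalRing L v)).charpoly).map (Pi.evalRingHom (fun w' : PlacesOver L v => w'.1.adicCompletion L) w)).IsRoot γ) (hαγ : α ≠ γ)
    -- an ARBITRARY admissible quadruple (the binders of (Σ)′): matched, pairwise non-conjugate, κ-signs `s·(−1)^(b₁)`, and THE PIN `(s : ℂ) = (y_λ, θ)_v`
    {t : Fin 2 → Fin 2 → ((cmDatum L 3 H').Local v)}
    (hmatch : ∀ b₀ b₁, IsLocalNormPair L H' v γH (t b₀ b₁)) (hinj : ∀ b₀ b₁ b₀' b₁', IsConj (t b₀ b₁) (t b₀' b₁') → b₀ = b₀' ∧ b₁ = b₁')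
    {s : ℤ} (hs : s = 1 ∨ s = -1) (hκ : ∀ b₀ b₁, finKappaAt L v H' γH (t b₀ b₁) = s * (-1) ^ (b₁ : ℕ))
    (hpin : (s : ℂ) = (hilbertSymbol (v.adicCompletion ↥(maximalRealSubfield L)) yl
      (algebraMap ↥(maximalRealSubfield L) _ ((cmQuadraticGenerator L : 𝓞 ↥(maximalRealSubfield L)) : ↥(maximalRealSubfield L))) : ℂ)) :
        ∃ (ε : (w.1.adicCompletion L))
          (e : ((cmDatum L 3 H').Local v) ≃ₜ*
            ↥(unitaryGroupOfForm (galAdicCompletionMap (L := L) (IsCMField.complexConj L) hw)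
              (placeForm (Matrix.of fun i j : Fin 3 => if i.val + j.val + 1 = 3 then (1 : L) else 0) w.1)))
          (P : Fin 2 → Fin 2 → GL (Fin 3) (w.1.adicCompletion L))
          (tf : Fin 2 → Fin 2 → ((cmDatum L 3 H').Local v)) (π : Fin 2 → Fin 2 → Fin 2),
          -- the twisting unit `ε`: `σ_w`-fixed, a unit, NOT a norm
          galAdicCompletionMap (L := L) (IsCMField.complexConj L) hw ε = ε ∧ Valued.v ε = 1 ∧ (¬ ∃ z : (w.1.adicCompletion L), z * galAdicCompletionMap (L := L) (IsCMField.complexConj L) hw z = ε) ∧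
          -- the one-place frame `e` of `G′_v` (★ p846897): (i) `e g = A · E(g) · A⁻¹`, (ii) `g ∈ K′ ↔ e g ∈ GL₃(𝒪_w)`, (iii) matching = conjugacy with `e b`
          (∀ g, ((e g).val : GL (Fin 3) (w.1.adicCompletion L)) =
            A * (((localNonsplitEquiv (IsCMField.complexConj L) H' (IsCMField.complexConj_ne_one L) w hw g)).val : GL (Fin 3) (w.1.adicCompletion L)) * A⁻¹) ∧
          (∀ g, g ∈ cmLocalIntegralLevel L 3 H' v ↔ ((e g).val : GL (Fin 3) (w.1.adicCompletion L)) ∈ glInt 3 (w.1.adicCompletion L)) ∧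
          (∀ γH' b, IsLocalNormPair L H' v γH' b ↔
            IsConj
              (endoGL
                (((localNonsplitEquiv (IsCMField.complexConj L)
                    (Matrix.of fun i j : Fin 2 => if i.val + j.val + 1 = 2 then (1 : L) else 0) (IsCMField.complexConj_ne_one L) w hw γH'.1).val :
                    GL (Fin 2) (w.1.adicCompletion L)),
                  ((localNonsplitEquiv (IsCMField.complexConj L)
                    (Matrix.of fun i j : Fin 1 => if i.val + j.val + 1 = 1 then (1 : L) else 0) (IsCMField.complexConj_ne_one L) w hw γH'.2).val :
                    GL (Fin 1) (w.1.adicCompletion L))))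
              ((e b).val : GL (Fin 3) (w.1.adicCompletion L))) ∧
          -- the spectrum `(α, u_w, γ)`: pairwise distinct, norm-one
          Function.Injective (![α, finGammaTwo L v γH w, γ] : Fin 3 → (w.1.adicCompletion L)) ∧ (∀ i, galAdicCompletionMap (L := L) (IsCMField.complexConj L) hw ((![α, finGammaTwo L v γH w, γ] : Fin 3 → (w.1.adicCompletion L)) i) * (![α, finGammaTwo L v γH w, γ] : Fin 3 → (w.1.adicCompletion L)) i = 1) ∧
          -- the four framed literals `e (t b₀ b₁) = P_b · diag(α, u_w, γ) · P_b⁻¹`, `ᵗσ̄_w P_b J₀ P_b = diag(ε^b₀, ε^b₁, −ε^(b₀+b₁))`, `P_b ∈ GL₃(𝒪_w)`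
          (∀ b₀ b₁,
            P b₀ b₁ ∈ glInt 3 (w.1.adicCompletion L) ∧
            formCongr (galAdicCompletionMap (L := L) (IsCMField.complexConj L) hw) (P b₀ b₁) ((StdForm.antidiagonal 3).over (w.1.adicCompletion L)) =
              diagonal ![ε ^ (b₀ : ℕ), ε ^ (b₁ : ℕ), -(ε ^ ((b₀ : ℕ) + (b₁ : ℕ)))] ∧
            (((e (tf b₀ b₁)).val : GL (Fin 3) (w.1.adicCompletion L)) : Matrix (Fin 3) (Fin 3) (w.1.adicCompletion L)) =
              (P b₀ b₁).val * diagonal ![α, finGammaTwo L v γH w, γ] * ((P b₀ b₁)⁻¹).val ∧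
            (((e (tf b₀ b₁)).val : GL (Fin 3) (w.1.adicCompletion L)) : Matrix (Fin 3) (Fin 3) (w.1.adicCompletion L)) * (P b₀ b₁).val = (P b₀ b₁).val * diagonal ![α, finGammaTwo L v γH w, γ] ∧
            ((((tf b₀ b₁).val : GL (Fin 3) (UnitaryGroup.LocalRing L v)) : Matrix (Fin 3) (Fin 3) (UnitaryGroup.LocalRing L v)).map
                (Pi.evalRingHom (fun w' : PlacesOver L v => w'.1.adicCompletion L) w)).charpoly =
              (Polynomial.X - Polynomial.C α) * (Polynomial.X - Polynomial.C (finGammaTwo L v γH w)) * (Polynomial.X - Polynomial.C γ) ∧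
            tf b₀ b₁ ∈ cmLocalIntegralLevel L 3 H' v ∧ IsLocalNormPair L H' v γH (tf b₀ b₁) ∧
            (∀ X Q : GL (Fin 3) (w.1.adicCompletion L), X.val * Q.val = Q.val * diagonal ![α, finGammaTwo L v γH w, γ] → IsConj X ((e (tf b₀ b₁)).val : GL (Fin 3) (w.1.adicCompletion L))) ∧
            (∀ b₀' b₁', IsConj (tf b₀ b₁) (tf b₀' b₁') → b₀ = b₀' ∧ b₁ = b₁')) ∧
          -- the κ-signs of the framed literals (same `s`), and THE RELABELLING: `t (π b₀ b₁) b₁ ~ tf b₀ b₁`, `π(·, b₁)` a bijection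
          (∀ b₀ b₁, finKappaAt L v H' γH (tf b₀ b₁) = s * (-1) ^ (b₁ : ℕ)) ∧
          (∀ b₁, Function.Bijective (fun b₀ => π b₀ b₁)) ∧ (∀ b₀ b₁, IsConj (t (π b₀ b₁) b₁) (tf b₀ b₁)) := by
  classical
  -- the framed package at the spectrum `(α, u_w, γ)` (★ (Lit⁺))
  have hpk := typeOne_literals_framed_ram L H' hH' w hw he hH'w h2 A hA hframe yl hyl γH hreg hlev hα hγ hαγ
  obtain ⟨ε, e, P, tf, s', hσε, hεv, hεN, hfe, hK, hmt, hxinj, hx1, htf, hs', hκ', hpin'⟩ := hpk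
  -- the two pins agree: `s' = s`
  have hss : s' = s := by
    have h : ((s' : ℤ) : ℂ) = ((s : ℤ) : ℂ) := hpin'.trans hpin.symm
    exact_mod_cast h
  -- the stable class of `tf 0 0` has exactly the four classes `⟦tf b⟧`
  have hHf := map_conjLocal_transpose_localForm L 3 H' v hH'
  have hH'u : IsUnit H' := by
    rw [Matrix.isUnit_iff_isUnit_det]
    have h := (Matrix.isUnit_iff_isUnit_det _).1 hH'w
    change IsUnit (H'.map (algebraMap L (w.1.adicCompletion L))).det at h
    rw [← RingHom.mapMatrix_apply, ← RingHom.map_det, isUnit_iff_ne_zero, _root_.map_ne_zero] at h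
    exact isUnit_iff_ne_zero.2 h
  have hHd := isUnit_det_localForm L 3 H' v ((Matrix.isUnit_iff_isUnit_det _).1 hH'u).ne_zero
  have hQ0 := onePlace_frame_of_conj_frame (hfe (tf 0 0)) (htf 0 0).2.2.2.1
  have hfr0 := exists_localRing_frame_of_onePlace_frame L v H' w hw (tf 0 0) hQ0 hxinj hx1
  obtain ⟨P₃, u', hP₃, -, -, hu', hu'1⟩ := hfr0
  obtain ⟨δ₁, hcδ, hδ⟩ : ∃ δ : L, IsCMField.complexConj L δ = -δ ∧ δ ≠ 0 := by
    obtain ⟨ζ, hζ⟩ := not_forall.1 fun h0 => IsCMField.complexConj_ne_one L (AlgEquiv.ext h0)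
    refine ⟨ζ - IsCMField.complexConj L ζ, by rw [map_sub, IsCMField.complexConj_apply_apply, neg_sub], fun h0 => hζ ?_⟩
    rw [sub_eq_zero] at h0
    exact h0.symm
  have hS4 := ncard_conjClassesIn_eq_four L v (IsCMField.complexConj L) hcδ hδ w hw hHf hHd (tf 0 0).2 hP₃ hu' hu'1
  have hSfin := finite_conjClassesIn_of_eigenframe L v (IsCMField.complexConj L) hcδ hδ w hw hHf hHd (tf 0 0).2 hP₃ hu' hu'1
  obtain ⟨g, hg⟩ : ∃ g : Fin 2 × Fin 2 → ConjClasses ((cmDatum L 3 H').Local v), ∀ b, g b = ConjClasses.mk (tf b.1 b.2) := ⟨_, fun b => rfl⟩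
  have hginj : Function.Injective g := by
    rintro ⟨b₀, b₁⟩ ⟨b₀', b₁'⟩ h
    rw [hg, hg] at h
    obtain ⟨h0, h1⟩ := (htf b₀ b₁).2.2.2.2.2.2.2.2 b₀' b₁' (ConjClasses.mk_eq_mk_iff_isConj.1 h)
    rw [h0, h1]
  have hsub : Set.range g ⊆ conjClassesIn (UnitaryGroup.conjLocal L (IsCMField.complexConj L) v)
      ((UnitaryGroup.adelicForm L 3 H').map (UnitaryGroup.adeleToLocal L v)) ⟨(tf 0 0).val, (tf 0 0).2⟩ := by
    rintro c ⟨⟨b₀, b₁⟩, rfl⟩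
    rw [hg]
    exact mk_mem_conjClassesIn_of_isLocalNormPair L v H' γH (htf 0 0).2.2.2.2.2.2.1 (htf b₀ b₁).2.2.2.2.2.2.1
  have h4 : (Set.range g).ncard = 4 := by
    rw [Set.ncard_range_of_injective hginj, Nat.card_prod, Nat.card_eq_fintype_card, Fintype.card_fin]
  have heq := Set.eq_of_subset_of_ncard_le hsub (Nat.le_of_eq (hS4.trans h4.symm)) hSfin
  -- every `t b` is one of the four classes: `f b` with `⟦tf (f b)⟧ = ⟦t b⟧`
  have hcls : ∀ b : Fin 2 × Fin 2, ∃ b' : Fin 2 × Fin 2, g b' = ConjClasses.mk (t b.1 b.2) := fun b => by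
    have hmem := mk_mem_conjClassesIn_of_isLocalNormPair L v H' γH (htf 0 0).2.2.2.2.2.2.1 (hmatch b.1 b.2)
    rw [← heq] at hmem
    exact hmem
  choose f hf using hcls
  have hconj : ∀ b : Fin 2 × Fin 2, IsConj (tf (f b).1 (f b).2) (t b.1 b.2) := fun b =>
    ConjClasses.mk_eq_mk_iff_isConj.1 ((hg (f b)).symm.trans (hf b))
  -- `κ` is a class function ⇒ the second label is preserved
  have hsnd : ∀ b : Fin 2 × Fin 2, (f b).2 = b.2 := fun b => by
    have h1 := finKappaAt_eq_of_isConj L v H' γH (tf (f b).1 (f b).2) (htf (f b).1 (f b).2).2.2.2.2.2.2.1 (hconj b)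
    rw [hκ b.1 b.2, hκ' (f b).1 (f b).2, hss] at h1
    have hs0 : (s : ℤ) ≠ 0 := by rcases hs with h | h <;> simp [h]
    have h2 := mul_left_cancel₀ hs0 h1
    -- `(-1)^(b₂) = (-1)^((f b)₂)` in `ℤ` with exponents in `Fin 2`
    rcases Fin.exists_fin_two.1 ⟨(f b).2, rfl⟩ with h0 | h0 <;> rcases Fin.exists_fin_two.1 ⟨b.2, rfl⟩ with h0' | h0' <;>
      simp only [h0, h0', Fin.val_zero, Fin.val_one, pow_zero, pow_one] at h2 ⊢ <;> norm_num at h2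
  -- `f` is injective (pairwise non-conjugacy of `t`), hence a bijection of `Fin 2 × Fin 2`
  have hfinj : Function.Injective f := fun b b' h => by
    have h1 : ConjClasses.mk (t b.1 b.2) = ConjClasses.mk (t b'.1 b'.2) := by rw [← hf b, ← hf b', h]
    obtain ⟨h0, h2⟩ := hinj b.1 b.2 b'.1 b'.2 (ConjClasses.mk_eq_mk_iff_isConj.1 h1)
    exact Prod.ext h0 h2
  have hfbij : Function.Bijective f := Finite.injective_iff_bijective.1 hfinj
  obtain ⟨σf, hσf_apply⟩ : ∃ σf : Fin 2 × Fin 2 ≃ Fin 2 × Fin 2, ∀ b, σf b = f b := ⟨Equiv.ofBijective f hfbij, fun b => rfl⟩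
  have hsnd' : ∀ c : Fin 2 × Fin 2, (σf.symm c).2 = c.2 := fun c => by
    have h := hsnd (σf.symm c)
    rw [← hσf_apply, Equiv.apply_symm_apply] at h
    exact h.symm
  refine ⟨ε, e, P, tf, fun b₀ b₁ => (σf.symm (b₀, b₁)).1, hσε, hεv, hεN, hfe, hK, hmt, hxinj, hx1, htf, ?_, ?_, ?_⟩
  · intro b₀ b₁; rw [hκ' b₀ b₁, hss]
  · intro b₁
    refine Finite.injective_iff_bijective.1 fun b₀ b₀' h => ?_
    have h2 : σf.symm (b₀, b₁) = σf.symm (b₀', b₁) := Prod.ext h (by rw [hsnd', hsnd'])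
    exact (Prod.ext_iff.1 (σf.symm.injective h2)).1
  · intro b₀ b₁
    have h := hconj (σf.symm (b₀, b₁))
    have h1 : f (σf.symm (b₀, b₁)) = (b₀, b₁) := by rw [← hσf_apply, Equiv.apply_symm_apply]
    rw [h1] at h
    have h2 : (σf.symm (b₀, b₁)).2 = b₁ := hsnd' (b₀, b₁)
    show IsConj (t (σf.symm (b₀, b₁)).1 b₁) (tf b₀ b₁)
    have h3 : t (σf.symm (b₀, b₁)).1 b₁ = t (σf.symm (b₀, b₁)).1 (σf.symm (b₀, b₁)).2 := by rw [h2]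
    rw [h3]
    exact h.symm

end FramedReduction

end Literature.NumberTheory.Rogawski1990

end
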